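import Literature.Computability.QuantumComplexity.BlockKit
import Literature.Computability.QuantumComplexity.DyadicPhaseThresholds
import HarnessLib

/-!
# The gadget kit of the Fourier block: the dyadic phase programs and a concrete well-formed kit

Topic `Literature/Computability/QuantumComplexity`, the bookkeeping companion of `BlockKit.lean` (the AJL
gadget kit) for the Fourier stage of Regev's quantum sampler (Regev 2009, Lemma 3.14; Nielsen–Chuang
2010, §5.1): the controlled phases `e(1/2^m)`, `2 ≤ m ≤ κ`, of the `κ`-qubit QFT are realised by the
Clifford+`T` phase gadgets (`PhaseGadgetAssemblyGen.lean`) with the dyadic sign predicates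
`SLP.qftPhaseB k (cosThr m k) (sinThr m k)` of `DyadicPhaseThresholds.lean`. This file

* lists the programs (`SLP.qftPrograms k κ`), proves their side conditions (`SLP.ok_qftPhaseB`: they read
  `k + 4` input bits — the averaging field, the selector, the dummy and the two phase wires) and widths
  (`SLP.maxBnd_qftPhaseB_lt`, all intermediate values fit in `thrWd k` bits);
* lays out a block of `qbsize κ k` wires — `κ` data wires, the dummy, the selector, `k` averaging wires,
  the reflection helpers, then the classical region sized for BOTH the AJL letter programs and the QFT
  programs (`qR`, `qF`, `qT`: maxima) — and proves the resulting `GadgetKit` well formed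
  (`QFTKit.kit_ok`, so that every kit lemma of `LetterWord.lean` applies) together with the bounds of
  the QFT programs (`QFTKit.q_R_ge`, `q_F_ge`, `q_T_ge`) and the position facts of the data wires
  (`QFTKit.data_facts`).

Everything here is proved; definitions have bodies; no named fact is introduced.

## References

* O. Regev, *On lattices, learning with errors, random linear codes, and cryptography*, J. ACM 56
  (2009), art. 34, Lemma 3.14 (proof: the Fourier transform step), §2 p. 11 [Regev2009].
* M. A. Nielsen, I. L. Chuang, *Quantum Computation and Quantum Information*, CUP 2010, §5.1 (the QFT
  circuit), §3.2.5 (ancilla bookkeeping) [NielsenChuang2010].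
-/

namespace Literature.Computability.QuantumComplexity

open Cryptography RevSim

namespace SLP

/-! ### The dyadic phase programs of the Fourier block -/

/-- **The phase programs of a `κ`-qubit QFT with `k` averaging bits**: one per phase denominator
`2^m`, `m ≤ κ` (only `2 ≤ m ≤ κ` are used). [cite: NielsenChuang2010, §5.1] -/
noncomputable def qftPrograms (k κ : ℕ) : List BExpr := (List.range (κ + 1)).map fun m => qftPhaseB k (cosThr m k) (sinThr m k)

/-- Membership of the program of denominator `2^m`. [folklore] -/
theorem qftPhaseB_mem {k κ m : ℕ} (hm : m ≤ κ) : qftPhaseB k (cosThr m k) (sinThr m k) ∈ qftPrograms k κ :=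
  List.mem_map.2 ⟨m, List.mem_range.2 (Nat.lt_succ_of_le hm), rfl⟩

/-- **Side conditions of the phase programs**: they read `k + 1 + 3` input bits. [folklore] -/
theorem ok_qftPhaseB (k Tre Tim : ℕ) : (qftPhaseB k Tre Tim).OK (thrWd k) (k + 1 + 3) := by
  have hW : 1 ≤ thrWd k := by unfold thrWd; omega
  obtain ⟨o0, -, -, -, -, -, -⟩ := thrB_ok k (kIn := k + 1 + 3) (by omega)
  have hb : (bitB k).OK (thrWd k) (k + 1 + 3) := bitB_ok (by omega) hW
  have ht : (trueB k).OK (thrWd k) (k + 1 + 3) := ⟨hb, hb⟩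
  have hc : (qftCtlB k).OK (thrWd k) (k + 1 + 3) := ok_conjB hW _ _ (by simp) (by omega)
  have hl : ∀ T, (ltConstB k (k + 1) T).OK (thrWd k) (k + 1 + 3) := fun T =>
    ltConstB_ok (by omega) (by unfold thrWd; omega) (by unfold thrWd; omega)
  unfold qftPhaseB phaseSignB
  exact ok_iteB hc (ok_iteB hb (hl Tim) (hl Tre)) (ok_iteB hb o0 ht)

/-- **Widths of the phase programs**: all intermediate values fit in `thrWd k` bits. [folklore] -/
theorem maxBnd_qftPhaseB_lt (k Tre Tim : ℕ) : (qftPhaseB k Tre Tim).maxBnd < 2 ^ thrWd k := by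
  obtain ⟨h0, -, -, -, -, -, -⟩ := thrB_maxBnd_lt k
  have h2' : (2 : ℕ) < 2 ^ thrWd k :=
    calc (2 : ℕ) < 2 ^ 2 := by norm_num
      _ ≤ 2 ^ thrWd k := Nat.pow_le_pow_right (by norm_num) (by unfold thrWd; omega)
  have hb : (bitB k).maxBnd < 2 ^ thrWd k := by rw [bitB_maxBnd]; exact h2'
  have ht : (trueB k).maxBnd < 2 ^ thrWd k := by simp only [trueB, BExpr.maxBnd, max_lt_iff]; exact ⟨hb, hb⟩
  have hc : (qftCtlB k).maxBnd < 2 ^ thrWd k := by rw [qftCtlB, maxBnd_conjB]; exact h2'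
  have hl : ∀ T, (ltConstB k (k + 1) T).maxBnd < 2 ^ thrWd k := fun T =>
    (ltConstB_maxBnd_le k (k + 1) T).trans_lt (max_lt (Nat.pow_lt_pow_right (by norm_num) (by unfold thrWd; omega))
      (Nat.pow_lt_pow_right (by norm_num) (by unfold thrWd; omega)))
  unfold qftPhaseB phaseSignB
  exact maxBnd_iteB_lt hc (maxBnd_iteB_lt hb (hl Tim) (hl Tre)) (maxBnd_iteB_lt hb h0 ht)

end SLP

namespace QFTKit

open BlockKit (lmax le_lmax)

/-! ### Sizes -/

/-- Registers needed by the QFT programs. [folklore] -/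
noncomputable def qftR (k κ : ℕ) : ℕ := lmax ((SLP.qftPrograms k κ).map fun b => (b.compile (SLP.thrWd k) 0 0).2.2.1)

/-- Flags needed by the QFT programs. [folklore] -/
noncomputable def qftF (k κ : ℕ) : ℕ := lmax ((SLP.qftPrograms k κ).map fun b => (b.compile (SLP.thrWd k) 0 0).2.2.2)

/-- Instruction slots needed by the QFT programs. [folklore] -/
noncomputable def qftT (k κ : ℕ) : ℕ := lmax ((SLP.qftPrograms k κ).map fun b => (b.compile (SLP.thrWd k) 0 0).1.length)

/-- Registers of the kit: enough for both program families. [folklore] -/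
noncomputable def qR (k κ : ℕ) : ℕ := max (BlockKit.kitR k) (qftR k κ)

/-- Flags of the kit. [folklore] -/
noncomputable def qF (k κ : ℕ) : ℕ := max (BlockKit.kitF k) (qftF k κ)

/-- Instruction slots of the kit. [folklore] -/
noncomputable def qT (k κ : ℕ) : ℕ := max (BlockKit.kitT k) (qftT k κ)

/-- The register bound dominates the QFT programs. [folklore] -/
theorem le_qR {k κ : ℕ} {b : SLP.BExpr} (hb : b ∈ SLP.qftPrograms k κ) : (b.compile (SLP.thrWd k) 0 0).2.2.1 ≤ qR k κ := by
  have h : (b.compile (SLP.thrWd k) 0 0).2.2.1 ≤ qftR k κ := le_lmax (List.mem_map.2 ⟨b, hb, rfl⟩)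
  exact h.trans (le_max_right _ _)

/-- The flag bound dominates the QFT programs. [folklore] -/
theorem le_qF {k κ : ℕ} {b : SLP.BExpr} (hb : b ∈ SLP.qftPrograms k κ) : (b.compile (SLP.thrWd k) 0 0).2.2.2 ≤ qF k κ := by
  have h : (b.compile (SLP.thrWd k) 0 0).2.2.2 ≤ qftF k κ := le_lmax (List.mem_map.2 ⟨b, hb, rfl⟩)
  exact h.trans (le_max_right _ _)

/-- The slot bound dominates the QFT programs. [folklore] -/
theorem le_qT {k κ : ℕ} {b : SLP.BExpr} (hb : b ∈ SLP.qftPrograms k κ) : (b.compile (SLP.thrWd k) 0 0).1.length ≤ qT k κ := by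
  have h : (b.compile (SLP.thrWd k) 0 0).1.length ≤ qftT k κ := le_lmax (List.mem_map.2 ⟨b, hb, rfl⟩)
  exact h.trans (le_max_right _ _)

-- the bounds are data for the layout only: never unfold them again
attribute [irreducible] qftR qftF qftT

/-- The size of the classical region. [folklore] -/
noncomputable def regionSize (k κ : ℕ) : ℕ := qR k κ * SLP.thrWd k + qF k κ + qT k κ * SLP.scrSize (SLP.thrWd k)

/-- Offset of the dummy wire: after the `κ` data wires. [folklore] -/
def dataOff (κ : ℕ) : ℕ := κ

/-- Base of the register block: after dummy, `cr`, `k` averaging wires and `k + regionSize` helpers. [folklore] -/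
noncomputable def rb (κ k : ℕ) : ℕ := dataOff κ + 2 + k + (k + regionSize k κ)

/-- The block size. [folklore] -/
noncomputable def qbsize (κ k : ℕ) : ℕ := rb κ k + regionSize k κ

/-- Blocks are nonempty. [folklore] -/
theorem qbsize_pos (κ k : ℕ) : 0 < qbsize κ k := by unfold qbsize rb dataOff; omega

variable (κ k : ℕ)

/-- Wire number `v` of the block. [folklore] -/
noncomputable def wire (v : ℕ) : Fin (qbsize κ k) := finOf (qbsize κ k) (qbsize_pos κ k) v

/-- `wire v` has value `v` below the block size. [folklore] -/
theorem wire_val {v : ℕ} (hv : v < qbsize κ k) : (wire κ k v : ℕ) = v := by rw [wire, finOf_of_lt _ hv]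

/-- `wire` is injective below the block size. [folklore] -/
theorem wire_inj {v v' : ℕ} (hv : v < qbsize κ k) (hv' : v' < qbsize κ k) (h : wire κ k v = wire κ k v') : v = v' := by
  have := congrArg Fin.val h; rwa [wire_val κ k hv, wire_val κ k hv'] at this

/-! ### The kit -/

/-- **The gadget kit of the Fourier block.** [folklore] -/
noncomputable def kit : GadgetKit (qbsize κ k) where
  hN := qbsize_pos κ k
  k := k
  as := (List.range k).map fun j => wire κ k (dataOff κ + 2 + j)
  cr := wire κ k (dataOff κ + 1)
  rb := rb κ k
  fb := rb κ k + qR k κ * SLP.thrWd k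
  sb := rb κ k + qR k κ * SLP.thrWd k + qF k κ
  R := qR k κ
  F := qF k κ
  T := qT k κ
  hs := (List.range (k + regionSize k κ)).map fun j => wire κ k (dataOff κ + 2 + k + j)
  d0 := wire κ k (dataOff κ)

/-- The fields of the kit (definitional). [folklore] -/
theorem kit_as : (kit κ k).as = (List.range k).map fun j => wire κ k (dataOff κ + 2 + j) := rfl
/-- The fields of the kit (definitional). [folklore] -/
theorem kit_cr : (kit κ k).cr = wire κ k (dataOff κ + 1) := rfl
/-- The fields of the kit (definitional). [folklore] -/
theorem kit_hs : (kit κ k).hs = (List.range (k + regionSize k κ)).map fun j => wire κ k (dataOff κ + 2 + k + j) := rfl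
/-- The fields of the kit (definitional). [folklore] -/
theorem kit_d0 : (kit κ k).d0 = wire κ k (dataOff κ) := rfl
/-- The fields of the kit (definitional). [folklore] -/
theorem kit_rb : (kit κ k).rb = rb κ k := rfl
/-- The fields of the kit (definitional). [folklore] -/
theorem kit_k : (kit κ k).k = k := rfl
/-- The fields of the kit (definitional). [folklore] -/
theorem kit_fb : (kit κ k).fb = rb κ k + qR k κ * SLP.thrWd k := rfl
/-- The fields of the kit (definitional). [folklore] -/
theorem kit_sb : (kit κ k).sb = rb κ k + qR k κ * SLP.thrWd k + qF k κ := rfl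
/-- The fields of the kit (definitional). [folklore] -/
theorem kit_T : (kit κ k).T = qT k κ := rfl
/-- The fields of the kit (definitional). [folklore] -/
theorem kit_R : (kit κ k).R = qR k κ := rfl
/-- The fields of the kit (definitional). [folklore] -/
theorem kit_F : (kit κ k).F = qF k κ := rfl

/-- The region of the kit has `regionSize` wires. [folklore] -/
theorem length_region : (kit κ k).region.length = regionSize k κ := by
  rw [GadgetKit.region, layoutRegion, List.length_map, List.length_append, List.length_append, List.length_map, List.length_map,
    List.length_map, List.length_range, List.length_range, List.length_range]
  rfl

/-- **The kit of the Fourier block is well formed** (for `k ≥ 1`). [folklore] -/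
theorem kit_ok (hk : 1 ≤ k) : (kit κ k).OK := by
  have hrb : rb κ k = dataOff κ + 2 + k + (k + regionSize k κ) := rfl
  have hb : qbsize κ k = rb κ k + regionSize k κ := rfl
  refine
    { len := by rw [kit_as, List.length_map, List.length_range]; rfl
      nodup := ?_
      had_lt := ?_
      d0_lt := by rw [kit_d0, kit_rb, wire_val κ k (by omega)]; omega
      d0_notin := ?_
      fb_ge := le_rfl
      sb_ge := le_rfl
      top_le := by rw [kit_sb, kit_T, show (kit κ k).Wd = SLP.thrWd k from rfl, hb, regionSize]; omega
      hs_len := by rw [List.length_append, length_region, kit_as, kit_hs, List.length_map, List.length_map, List.length_range, List.length_range]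
      hs_ne := by rw [kit_hs]; intro h; have := congrArg List.length h; rw [List.length_map, List.length_range] at this; simp at this; omega
      hs_nodup := ?_
      hs_low := ?_
      hs_had := ?_
      hs_d0 := ?_
      R_ge := fun b hb' => (BlockKit.le_kitR hb').trans (le_max_left _ _)
      F_ge := fun b hb' => (BlockKit.le_kitF hb').trans (le_max_left _ _)
      T_ge := fun b hb' => (BlockKit.le_kitT hb').trans (le_max_left _ _) }
  · -- nodup (cr :: as)
    rw [kit_cr, kit_as, List.nodup_cons]
    refine ⟨fun h => ?_, ?_⟩
    · rw [List.mem_map] at h; obtain ⟨j, hj, h⟩ := h; rw [List.mem_range] at hj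
      have := wire_inj κ k (by omega) (by omega) h; omega
    · refine List.nodup_range.map_on fun j hj j' hj' h => ?_
      rw [List.mem_range] at hj hj'
      have := wire_inj κ k (by omega) (by omega) h; omega
  · -- had_lt
    intro a ha
    rw [kit_cr, kit_as, List.mem_cons, List.mem_map] at ha
    rw [kit_rb]
    rcases ha with rfl | ⟨j, hj, rfl⟩
    · rw [wire_val κ k (by omega)]; omega
    · rw [List.mem_range] at hj; rw [wire_val κ k (by omega)]; omega
  · -- d0_notin
    rw [kit_d0, kit_cr, kit_as, List.mem_cons, List.mem_map, not_or]
    refine ⟨fun h => ?_, ?_⟩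
    · have := wire_inj κ k (by omega) (by omega) h; omega
    · rintro ⟨j, hj, h⟩; rw [List.mem_range] at hj
      have := wire_inj κ k (by omega) (by omega) h; omega
  · -- hs_nodup
    rw [kit_hs]
    refine List.nodup_range.map_on fun j hj j' hj' h => ?_
    rw [List.mem_range] at hj hj'
    have := wire_inj κ k (by omega) (by omega) h; omega
  · -- hs_low
    intro h hh
    rw [kit_hs, List.mem_map] at hh
    obtain ⟨j, hj, rfl⟩ := hh
    rw [List.mem_range] at hj
    rw [kit_rb, wire_val κ k (by omega)]; omega
  · -- hs_had
    intro h hh hmem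
    rw [kit_hs, List.mem_map] at hh
    obtain ⟨j, hj, rfl⟩ := hh
    rw [List.mem_range] at hj
    rw [kit_cr, kit_as, List.mem_cons, List.mem_map] at hmem
    rcases hmem with h1 | ⟨j', hj', h2⟩
    · have := wire_inj κ k (by omega) (by omega) h1; omega
    · rw [List.mem_range] at hj'
      have := wire_inj κ k (by omega) (by omega) h2.symm; omega
  · -- hs_d0
    rw [kit_d0, kit_hs, List.mem_map]
    rintro ⟨j, hj, h⟩
    rw [List.mem_range] at hj
    have := wire_inj κ k (by omega) (by omega) h; omega

/-- The bounds of the kit dominate the QFT programs. [folklore] -/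
theorem q_bounds {m : ℕ} (hm : m ≤ κ) :
    ((SLP.qftPhaseB k (SLP.cosThr m k) (SLP.sinThr m k)).compile (kit κ k).Wd 0 0).2.2.1 ≤ (kit κ k).R ∧
    ((SLP.qftPhaseB k (SLP.cosThr m k) (SLP.sinThr m k)).compile (kit κ k).Wd 0 0).2.2.2 ≤ (kit κ k).F ∧
    ((SLP.qftPhaseB k (SLP.cosThr m k) (SLP.sinThr m k)).compile (kit κ k).Wd 0 0).1.length ≤ (kit κ k).T :=
  ⟨le_qR (SLP.qftPhaseB_mem hm), le_qF (SLP.qftPhaseB_mem hm), le_qT (SLP.qftPhaseB_mem hm)⟩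

/-- **The data wires**: wire `j < κ` of the block. [folklore] -/
noncomputable def dataWire (j : Fin κ) : Fin (qbsize κ k) := wire κ k j

/-- The data wires as an embedding. [folklore] -/
noncomputable def dataEmb : Fin κ ↪ Fin (qbsize κ k) :=
  ⟨dataWire κ k, fun j j' h => Fin.ext (wire_inj κ k (by unfold qbsize rb dataOff; omega) (by unfold qbsize rb dataOff; omega) h)⟩

/-- The value of a data wire. [folklore] -/
theorem dataEmb_val (j : Fin κ) : (dataEmb κ k j : ℕ) = j := wire_val κ k (by unfold qbsize rb dataOff; omega)

/-- **Position facts of the data wires**: below the register base, not the dummy, not a Hadamard wire,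
not a helper. [folklore] -/
theorem data_facts (j : Fin κ) :
    (dataEmb κ k j : ℕ) < (kit κ k).rb ∧ dataEmb κ k j ≠ (kit κ k).d0 ∧ dataEmb κ k j ∉ (kit κ k).cr :: (kit κ k).as ∧
      dataEmb κ k j ∉ (kit κ k).hs := by
  have hv := dataEmb_val κ k j
  have hj : (j : ℕ) < κ := j.2
  have hb : qbsize κ k = κ + 2 + k + (k + regionSize k κ) + regionSize k κ := rfl
  refine ⟨?_, ?_, ?_, ?_⟩
  · rw [kit_rb, hv]; unfold rb dataOff; omega
  · intro h
    have := congrArg Fin.val h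
    rw [hv, kit_d0, wire_val κ k (by unfold dataOff; omega)] at this
    unfold dataOff at this; omega
  · rw [kit_cr, kit_as, List.mem_cons, List.mem_map, not_or]
    refine ⟨fun h => ?_, ?_⟩
    · have := congrArg Fin.val h
      rw [hv, wire_val κ k (by unfold dataOff; omega)] at this
      unfold dataOff at this; omega
    · rintro ⟨i, hi, h⟩; rw [List.mem_range] at hi
      have := congrArg Fin.val h
      rw [hv, wire_val κ k (by unfold dataOff; omega)] at this
      unfold dataOff at this; omega
  · rw [kit_hs, List.mem_map]
    rintro ⟨i, hi, h⟩; rw [List.mem_range] at hi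
    have := congrArg Fin.val h
    rw [hv, wire_val κ k (by unfold dataOff; omega)] at this
    unfold dataOff at this; omega

end QFTKit

end Literature.Computability.QuantumComplexity
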